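import Summits.AtomisticToContinuum.Crystallization.Theorems.ChartedZeroExcessLayeredLatticeLiouvilleXU

/-!
# Zero-excess layered lattice Liouville — part XV (lens-2 g59, node «SBGlueD3»): the constants are CHOSEN from the eight structural antecedents

Critic rows 1133/1135 (part D «every constant of the tower is produced, in prefix order, from the antecedents»), leaf (2) `SubWindowBudgetGlueBPG` of
`stmt-AtomisticToContinuum-26636`.

`SBPre.Pack Q δ` = the analytic packages the tower hypothesis `TH` consumes, at the constants of `Q`: the UTS chart class `(κ₀, c₀, C₁)` at
`Q.a`, the linearisation-defect and pair-force-Taylor bounds, the harmonic-comparison and linear-decay packages at the floors `(c₀/2, 2C₁, κ₀/2)` and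
range `Q.ϱ`, the tail-flux bound at `(Q.εf, Q.ϱ, Q.AT)` on `δ`-separated door sets, and equilibrium re-charting at `(Q.ε, Q.ϱ, Q.m₀, Q.CR)`.
★ `SBPre.exists_pack`: from `TailDominationCert`, `LinearExcessDecayZ`, `HarmonicComparisonZ`, `LinearisationDefectP`, `EquilChartStrainP (1/25) 3
(1/1000)`, `PairForceTaylorP`, `TailFluxBSP 1 3 (1/16) (1/25)`, `UniformTameStabilityE (1/50) 2 (1/2000)` and `δ, a, C_g` there is `Q : SBPre` with
`Q.δ = min δ 1`, `Q.a = a`, `Q.Cg = C_g` and `Q.Pack δ` (in particular `Q.OK`): the order of choice is UTS → floors (`floor_packages`) → `C_T` → `t_C,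
K_w, k₀` → `ε_f, ε` → `ϱ = max(ϱ₁, ϱ₀ᵀ, ϱ₂)` → `A_T, m₀, C_R, n₁` → `ds` → `nlo`.
-/

noncomputable section

open scoped BigOperators InnerProductSpace RealInnerProductSpace
open Set Function Metric
open Summit.AtomisticToContinuum.Crystallization.Theorems.ChartedPlanarOrderRigidityDoor (E3 IsClean IsNash atomsIn)
open Summit.AtomisticToContinuum.Crystallization.Theorems.ChartedPlanarOrderDensityDichotomy (μS IsSep nK nK_nonneg)
open Summit.AtomisticToContinuum.Crystallization.Theorems.ChartedPlanarOrderCleanScaleP (IsCleanP IsDoorSetP isCleanP_one_iff)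
open Summit.AtomisticToContinuum.Crystallization.Theorems.ChartedPlanarOrderMesoCut (LayeredHom)
open Summit.AtomisticToContinuum.Crystallization.Theorems.ChartedPlanarOrderDoorLayered (Layered layeredHom_eq_layered atomsIn_subset)
open Summit.AtomisticToContinuum.Crystallization.Theorems.ChartedPlanarOrderDoorLayeredOsc (IsTwoShellAffineGood)

namespace Summit.AtomisticToContinuum.Crystallization.Theorems.ChartedZeroExcessLayeredLatticeLiouville

namespace SBPre

/-- ★ the analytic packages of the tower at the constants of `Q`, for `δ`-separated door sets (module docstring). [this file, g59] -/
structure Pack (Q : SBPre) (δ : ℝ) : Prop where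
  ok : Q.OK
  uts : ∀ (L : E3 ≃L[ℝ] E3) (w : ℤ → E3), IsEquilChart Q.a (1 / 50) 2 L w → IsEnergyNear (1 / 2000) (LayeredHom (L : E3 →L[ℝ] E3) w) →
    ∃ w' : ℤ → E3, Layered (chartGen₁ L) (chartGen₂ L) w' = LayeredHom (L : E3 →L[ℝ] E3) w ∧ IsLayeredCrystal Q.c₀ (chartGen₁ L) (chartGen₂ L) w' ∧
      IsTameIndexing Q.C₁ (chartGen₁ L) (chartGen₂ L) w' ∧ CoerciveZ (layeredKernel (chartGen₁ L) (chartGen₂ L) w') Q.κ₀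
  lin : LinearisationDefectP
  CT : ∀ z v : E3, 27 / 32 ≤ ‖z‖ → ‖v‖ ≤ 1 / 4 → ‖defectKernel z v‖ ≤ Q.CT * ‖v‖ ^ 2
  HC : ∀ (a b : E3) (w : ℤ → E3) (c C κ : ℝ), Q.c₀ / 2 ≤ c → C ≤ 2 * Q.C₁ → Q.κ₀ / 2 ≤ κ → IsLayeredCrystal c a b w →
    IsTameIndexing C a b w → CoerciveZ (layeredKernel a b w) κ → HCPackage Q.κ₁ Q.ϱ a b w
  LD : ∀ (a b : E3) (w : ℤ → E3) (c C κ : ℝ), Q.c₀ / 2 ≤ c → C ≤ 2 * Q.C₁ → Q.κ₀ / 2 ≤ κ → IsLayeredCrystal c a b w →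
    IsTameIndexing C a b w → CoerciveZ (layeredKernel a b w) κ → ModalDecayAt Q.CL Q.ϱ Q.tC Q.n₁ a b w ∧ ModeRigidAt Q.CL Q.ϱ Q.n₁ a b w
  TF : ∀ S : Set E3, IsDoorSetP 1 δ S → (∀ q ∈ S, IsTwoShellAffineGood (1 / 16) S q) →
    ∀ (L : E3 ≃L[ℝ] E3) (w : ℤ → E3), IsEquilChart Q.a (1 / 25) 3 L w → ∀ Ψ : E3 → E3,
    Set.BijOn Ψ S (LayeredHom (L : E3 →L[ℝ] E3) w) → (∀ x ∈ S, ∀ p ∈ S, dist p x ≤ 4 → dist (Ψ p) (Ψ x) ≤ 9) →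
    (∀ x ∈ S, ∀ p ∈ S, dist (Ψ p) (Ψ x) ≤ 3 → dist p x ≤ 8) → ∀ x ∈ S, ∀ t τ Θ : ℝ, 8 * Q.ϱ ≤ t → t < τ → 0 ≤ Θ →
    (∀ ρ : ℝ, τ ≤ ρ → bondEnergy (S ∩ ball x ρ) (fun p => p - Ψ p) ≤ Θ * (ρ / τ) * nK (S ∩ ball x ρ)) →
    ∀ φ : E3 → E3, (∀ y : E3, y ∉ S ∩ ball x t → φ y = 0) →
      |∑ᶠ y ∈ S ∩ ball x t, ⟪tailForce Q.ϱ S (LayeredHom (L : E3 →L[ℝ] E3) w) Ψ y, φ y⟫_ℝ| ≤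
        (Q.εf * Real.sqrt (bondEnergy (S ∩ ball x τ) (fun p => p - Ψ p)) +
          Q.AT * Real.sqrt (Θ * nK (S ∩ ball x τ)) / max (τ - t) 1) * Real.sqrt (bondEnergy (S ∩ ball x τ) φ)
  RC : ∀ (s Λ ν κ c C m : ℝ), Q.κ₀ / 2 ≤ κ → Q.c₀ / 2 ≤ c → C ≤ 2 * Q.C₁ → 0 ≤ m → m ≤ Q.m₀ → s + Q.CR * m ≤ 1 / 25 →
    Λ + Q.CR * m ≤ 3 → ν + Q.CR * m ≤ 1 / 1000 → ∀ (L : E3 ≃L[ℝ] E3) (w w₁ : ℤ → E3), IsEquilChart Q.a s Λ L w →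
    IsEnergyNear ν (LayeredHom (L : E3 →L[ℝ] E3) w) → Layered (chartGen₁ L) (chartGen₂ L) w₁ = LayeredHom (L : E3 →L[ℝ] E3) w →
    IsLayeredCrystal c (chartGen₁ L) (chartGen₂ L) w₁ → IsTameIndexing C (chartGen₁ L) (chartGen₂ L) w₁ →
    CoerciveZ (layeredKernel (chartGen₁ L) (chartGen₂ L) w₁) κ → ∀ M : Cell 2 → ℤ → E3, IsTruncMode Q.ϱ (chartGen₁ L) (chartGen₂ L) w₁ M →
    IsIdxLipschitz m M → ∃ (L' : E3 ≃L[ℝ] E3) (w' w₁' : ℤ → E3), IsEquilChart Q.a (s + Q.CR * m) (Λ + Q.CR * m) L' w' ∧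
      IsEnergyNear (ν + Q.CR * m) (LayeredHom (L' : E3 →L[ℝ] E3) w') ∧ Layered (chartGen₁ L') (chartGen₂ L') w₁' = LayeredHom (L' : E3 →L[ℝ] E3) w' ∧
      IsLayeredCrystal (c - Q.CR * m) (chartGen₁ L') (chartGen₂ L') w₁' ∧ IsTameIndexing (C + Q.CR * m) (chartGen₁ L') (chartGen₂ L') w₁' ∧
      CoerciveZ (layeredKernel (chartGen₁ L') (chartGen₂ L') w₁') (κ - Q.CR * m) ∧
      ∀ X Y : Cell 2 × ℤ, ‖(lsite (chartGen₁ L') (chartGen₂ L') w₁' Y.1 Y.2 - lsite (chartGen₁ L) (chartGen₂ L) w₁ Y.1 Y.2 - M Y.1 Y.2) -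
        (lsite (chartGen₁ L') (chartGen₂ L') w₁' X.1 X.2 - lsite (chartGen₁ L) (chartGen₂ L) w₁ X.1 X.2 - M X.1 X.2)‖ ≤ (Q.CR * m ^ 2 + Q.ε * m) * dist X Y

/-! ### XV.1  Signs from the chart class and the floor `C_L` only -/

section Signs

variable {Q : SBPre} (hCL : 1 ≤ Q.CL) (hc₀ : 0 < Q.c₀) (hC₁ : 0 < Q.C₁)
include hCL hc₀ hC₁

/-- `Bγ_pos'` (docstring added by the landing lane; see the module docstring). [formal bookkeeping] -/
theorem Bγ_pos' : 0 < Q.Bγ := by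
  unfold Bγ θ₁ Rhist Cm rN tC Kw; positivity

omit hc₀ hC₁ in
/-- `Cm_pos'` (docstring added by the landing lane; see the module docstring). [formal bookkeeping] -/
theorem Cm_pos' : 0 < Q.Cm := by unfold Cm rN tC; positivity

omit hc₀ hC₁ in
/-- `θ₁_pos'` (docstring added by the landing lane; see the module docstring). [formal bookkeeping] -/
theorem θ₁_pos' : 0 < Q.θ₁ := by unfold θ₁ tC; positivity

end Signs

/-! ### XV.2  The choice of the constants -/

/-- ★ the constants of the scheme are produced, in prefix order, from the eight structural antecedents (module docstring). [this file, g59] -/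
theorem exists_pack (hTD : TailDominationCert) (hLD : LinearExcessDecayZ) (hHC : HarmonicComparisonZ) (hLin : LinearisationDefectP)
    (hRC : EquilChartStrainP (1 / 25) 3 (1 / 1000)) (hPFT : PairForceTaylorP) (hTF : TailFluxBSP 1 3 (1 / 16) (1 / 25))
    (hUTS : UniformTameStabilityE (1 / 50) 2 (1 / 2000)) {δ a Cg : ℝ} (hδ : 0 < δ) (ha : 0 < a) (hCg : 1 ≤ Cg) :
    ∃ Q : SBPre, Q.δ = min δ 1 ∧ Q.a = a ∧ Q.Cg = Cg ∧ Q.Pack δ := by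
  -- the UTS chart class
  obtain ⟨κ₀, hκ₀, c₀', hc₀', C₁', hC₁', hU⟩ := hUTS a ha
  obtain ⟨c₀, hc₀c, hc₀1, hc₀⟩ : ∃ c : ℝ, c ≤ c₀' ∧ c ≤ 1 ∧ 0 < c := ⟨min c₀' 1, min_le_left _ _, min_le_right _ _, lt_min hc₀' one_pos⟩
  obtain ⟨C₁, hC₁C, hC₁1⟩ : ∃ C : ℝ, C₁' ≤ C ∧ 1 ≤ C := ⟨max C₁' 1, le_max_left _ _, le_max_right _ _⟩
  have hC₁ : 0 < C₁ := by linarith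
  -- the floor packages and the defect kernel
  obtain ⟨CL, hCL, κ₁, hκ₁, ϱ₁, hϱ₁, hFP⟩ := floor_packages hTD hLD hHC hκ₀ hc₀ hC₁
  obtain ⟨CT, hCT, hCTb⟩ := norm_defectKernel_le hPFT
  -- the scale ratio, the history window, `k₀`
  have htC1 : 1 / (8 * CL) < 1 := by rw [div_lt_one (by positivity)]; linarith
  have hKw : 0 < 504 * C₁ / c₀ + 2 := by positivity
  obtain ⟨k₀, hk₀⟩ := exists_pow_lt_of_lt_one (by positivity : 0 < 1 / (504 * C₁ / c₀ + 2)) htC1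
  let Q₀ : SBPre := ⟨min δ 1, a, Cg, c₀, C₁, κ₀, CL, κ₁, CT, k₀, 0, 0, 0, 0, 0, 0, 0, 0, 0⟩
  have hBγ : 0 < Q₀.Bγ := Bγ_pos' hCL hc₀ hC₁
  have hCm : 0 < Q₀.Cm := Cm_pos' hCL
  have hθ₁ : 0 < Q₀.θ₁ := θ₁_pos' hCL
  -- the tolerances `ε_f`, `ε`
  have hXf : 0 < (4 + 8 * CL) * (3 / κ₁ ^ 2) * (Q₀.dA ^ 2 + 1) := by positivity
  obtain ⟨εf, hεf, hεf1, hεfB⟩ : ∃ e : ℝ, 0 < e ∧ e ≤ 1 ∧ e ≤ Q₀.Bγ / (2 * ((4 + 8 * CL) * (3 / κ₁ ^ 2) * (Q₀.dA ^ 2 + 1))) :=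
    ⟨min 1 (Q₀.Bγ / (2 * ((4 + 8 * CL) * (3 / κ₁ ^ 2) * (Q₀.dA ^ 2 + 1)))), lt_min one_pos (by positivity), min_le_left _ _, min_le_right _ _⟩
  obtain ⟨ε, hε, hε1, hεB⟩ : ∃ e : ℝ, 0 < e ∧ e ≤ 1 / 2 ∧ e ≤ Q₀.θ₁ / (1728 * Q₀.Cm) :=
    ⟨min (1 / 2) (Q₀.θ₁ / (1728 * Q₀.Cm)), lt_min (by norm_num) (by positivity), min_le_left _ _, min_le_right _ _⟩
  -- the range `ϱ`
  obtain ⟨ϱT, hϱT, hTF₁⟩ := hTF δ hδ a ha εf hεf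
  obtain ⟨ϱ₂, hϱ₂, hRC₁⟩ := hRC a ha (κ₀ / 2) (by positivity) (c₀ / 2) (by positivity) (2 * C₁) (by positivity) ε hε
  obtain ⟨ϱ, hϱ1, hϱT', hϱ2⟩ : ∃ r : ℝ, ϱ₁ ≤ r ∧ ϱT ≤ r ∧ ϱ₂ ≤ r :=
    ⟨max (max ϱ₁ ϱT) ϱ₂, (le_max_left _ _).trans (le_max_left _ _), (le_max_right _ _).trans (le_max_left _ _), le_max_right _ _⟩
  have hϱ : 1 ≤ ϱ := hϱ₁.trans hϱ1
  obtain ⟨AT, hAT, hTFall⟩ := hTF₁ ϱ hϱT'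
  obtain ⟨m₀, hm₀, CR, hCR, hRCall⟩ := hRC₁ ϱ hϱ2
  obtain ⟨hHCall, hLDt⟩ := hFP ϱ hϱ1
  obtain ⟨n₁, hn₁, hLDall⟩ := hLDt (1 / (8 * CL)) (by positivity) (by rw [div_le_div_iff₀ (by positivity) (by norm_num)]; linarith)
  -- the coherence slack target `ds`
  have hXd : 0 < (4 + 8 * CL) * (3 / κ₁ ^ 2) * ((1 / 2 * CT * dictA (c₀ / 2) ϱ) ^ 2 + 1) := by positivity
  obtain ⟨ds, hds, hds4, hdsB⟩ : ∃ e : ℝ, 0 < e ∧ e ≤ 1 / 4 ∧ e ≤ Q₀.Bγ / (2 * ((4 + 8 * CL) * (3 / κ₁ ^ 2) * ((1 / 2 * CT * dictA (c₀ / 2) ϱ) ^ 2 + 1))) :=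
    ⟨min (1 / 4) (Q₀.Bγ / (2 * ((4 + 8 * CL) * (3 / κ₁ ^ 2) * ((1 / 2 * CT * dictA (c₀ / 2) ϱ) ^ 2 + 1)))), lt_min (by norm_num) (by positivity),
      min_le_left _ _, min_le_right _ _⟩
  -- the bottom scale `nlo`
  let Q₁ : SBPre := ⟨min δ 1, a, Cg, c₀, C₁, κ₀, CL, κ₁, CT, k₀, εf, ε, ϱ, AT, m₀, CR, n₁, ds, 0⟩
  obtain ⟨nlo, hnlo1, hnlon, hnlom, hnlot, hnloμ, hnloB⟩ : ∃ N : ℝ, 1 ≤ N ∧ n₁ ≤ N ∧ (32 * ϱ + 48) * (18 / c₀) + 2 * ϱ / c₀ + 1 ≤ N ∧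
      (8 * ϱ + 10) / C₁ ≤ N ∧ 4 * Q₁.Cm * Q₁.g₁ ≤ N ∧ 32 * Q₁.tC ^ 2 * Q₁.G₁ * Q₁.A₁ ≤ N := by
    refine ⟨max (max (max 1 n₁) (max ((32 * ϱ + 48) * (18 / c₀) + 2 * ϱ / c₀ + 1) ((8 * ϱ + 10) / C₁)))
      (max (4 * Q₁.Cm * Q₁.g₁) (32 * Q₁.tC ^ 2 * Q₁.G₁ * Q₁.A₁)), ?_, ?_, ?_, ?_, ?_, ?_⟩
    · exact ((le_max_left _ _).trans (le_max_left _ _)).trans (le_max_left _ _)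
    · exact ((le_max_right _ _).trans (le_max_left _ _)).trans (le_max_left _ _)
    · exact ((le_max_left _ _).trans (le_max_right _ _)).trans (le_max_left _ _)
    · exact ((le_max_right _ _).trans (le_max_right _ _)).trans (le_max_left _ _)
    · exact (le_max_left _ _).trans (le_max_right _ _)
    · exact (le_max_right _ _).trans (le_max_right _ _)
  refine ⟨⟨min δ 1, a, Cg, c₀, C₁, κ₀, CL, κ₁, CT, k₀, εf, ε, ϱ, AT, m₀, CR, n₁, ds, nlo⟩, rfl, rfl, rfl, ?_⟩
  -- the inequalities
  have hOK : (⟨min δ 1, a, Cg, c₀, C₁, κ₀, CL, κ₁, CT, k₀, εf, ε, ϱ, AT, m₀, CR, n₁, ds, nlo⟩ : SBPre).OK :=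
    { hδ := lt_min hδ one_pos, hδ1 := min_le_right _ _, ha := ha, hCg := hCg, hc₀ := hc₀, hc₀1 := hc₀1, hcC := by show c₀ ≤ C₁; linarith,
      hκ₀ := hκ₀, hCL := hCL, hκ₁ := hκ₁, hCT := hCT.le,
      hKwk := by
        show (504 * C₁ / c₀ + 2) * (1 / (8 * CL)) ^ k₀ ≤ 1
        rw [mul_comm]; exact ((lt_div_iff₀ hKw).1 hk₀).le,
      hεf := hεf, hεf1 := hεf1,
      hεfB := by
        show (4 + 8 * CL) * (3 / κ₁ ^ 2) * (Q₀.dA ^ 2 + 1) * εf ≤ Q₀.Bγ / 2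
        calc (4 + 8 * CL) * (3 / κ₁ ^ 2) * (Q₀.dA ^ 2 + 1) * εf
            ≤ (4 + 8 * CL) * (3 / κ₁ ^ 2) * (Q₀.dA ^ 2 + 1) * (Q₀.Bγ / (2 * ((4 + 8 * CL) * (3 / κ₁ ^ 2) * (Q₀.dA ^ 2 + 1)))) :=
              mul_le_mul_of_nonneg_left hεfB hXf.le
          _ = Q₀.Bγ / 2 := by field_simp,
      hε := hε, hε1 := hε1,
      hεs := by
        show 1728 * Q₀.Cm * ε ^ 2 ≤ Q₀.θ₁
        rw [le_div_iff₀ (by positivity)] at hεB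
        nlinarith,
      hϱ := hϱ, hAT := hAT, hm₀ := hm₀, hCR := hCR, hn₁ := hn₁, hds := hds, hds4 := hds4,
      hdsB := by
        show (4 + 8 * CL) * (3 / κ₁ ^ 2) * ((1 / 2 * CT * dictA (c₀ / 2) ϱ) ^ 2 + 1) * ds ≤ Q₀.Bγ / 2
        calc (4 + 8 * CL) * (3 / κ₁ ^ 2) * ((1 / 2 * CT * dictA (c₀ / 2) ϱ) ^ 2 + 1) * ds
            ≤ (4 + 8 * CL) * (3 / κ₁ ^ 2) * ((1 / 2 * CT * dictA (c₀ / 2) ϱ) ^ 2 + 1) *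
                (Q₀.Bγ / (2 * ((4 + 8 * CL) * (3 / κ₁ ^ 2) * ((1 / 2 * CT * dictA (c₀ / 2) ϱ) ^ 2 + 1)))) :=
              mul_le_mul_of_nonneg_left hdsB hXd.le
          _ = Q₀.Bγ / 2 := by field_simp,
      hnlo := hnlo1, hnlo₁ := hnlon, hnlom := hnlom,
      hnlot := by show 8 * ϱ + 10 ≤ C₁ * nlo; have := (div_le_iff₀ hC₁).1 hnlot; linarith,
      hnloμ := hnloμ, hnloB := hnloB }
  exact
    { ok := hOK,
      uts := fun L w hch hnear => by
        obtain ⟨w', hlay, hcr, htm, hco⟩ := hU L w hch hnear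
        exact ⟨w', hlay, hcr.mono hc₀c, htm.mono hC₁C, hco⟩,
      lin := hLin, CT := hCTb, HC := hHCall, LD := hLDall, TF := hTFall, RC := hRCall }

end SBPre

end Summit.AtomisticToContinuum.Crystallization.Theorems.ChartedZeroExcessLayeredLatticeLiouville

end
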